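import Summits.HodgeConjecture.CorCM.GaloisBalancedCertificateLift
import Summits.HodgeConjecture.CorCM.GaloisAnnihilatorCertificates
import HarnessLib

/-!
# LIFTING WEIGHT CERTIFICATES FROM A SUBGROUP: a non-zero antisymmetric annihilated RATIONAL WEIGHT on `H₀ ≤ Gal(K/ℚ)`
# with zero sums along a normal subgroup `N` makes `K` BAD

COR-CM (cell `pub-hodgecm2`), binder seat b04 (gen 41), count-neutral own lane «Galois-CM-type classification».  KERNEL ONLY:
theorems; no definition, no named fact, no `sorry`.  `HC_CM` is neither used nor claimed.

Gen 39's `CorCM/GaloisBalancedCertificateLift` transports a balanced SET certificate `(T₁, D₁)` from a subgroup `ι : H₀ ↪ Gal(K/ℚ)`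
(through complex conjugation `c = ι(c₁)`, over a normal subgroup `N` of `Gal` inside `ι(H₀)` with `c ∉ N ≠ 1`) to `Gal(K/ℚ)`.  This file
does the same for the WEIGHT format of gen 20/31 (`CorCM/GaloisAnnihilatorCertificates`: a CM set `T₁` with trivial left stabiliser and
a non-zero `c₁`-antisymmetric `b₁ : H₀ → ℚ` annihilated by all right translates of `T₁`, `Σ_{s∈T₁} b₁(s g) = 0`), under the hypothesis
that `b₁` has ZERO SUMS along the right cosets of `ι⁻¹(N)`: `Σ_{n∈N₁} b₁(h n) = 0` (`ι(N₁) = N`).  THE LIFT: `T = ι(T₁) ∪ (S₀ ∖ ι(H₀))` for a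
right-`N`-invariant CM set `S₀` of `Gal` (gen 39), `b = ι_* b₁` (zero off `ι(H₀)`); for `g ∉ ι(H₀)` the sum `Σ_{s∈T} b(s g)` runs over
`{x ∈ H₀ : ι(x) g⁻¹ ∈ S₀}`, a union of right `ι⁻¹(N)`-cosets (normality of `N` and `N`-invariance of `S₀`), hence vanishes.  The weights
that arise from a singular odd two-sheet block (`CorCM/TwoSheetDegenerateBalanced`, `N = C_p`) satisfy the hypothesis, so a CHARACTER
IDENTITY on a two-sheet subgroup `Q_{4m} × C_p ↪ Gal(K/ℚ)` through `c` with `C_p` normal makes `K` BAD — with no balanced set to search.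

* §1 `sum_filter_eq_zero_of_coset_sums` (averaging over `N₁`), **`exists_weight_certificate_of_subgroup`** (abstract lift).
* §2 `exists_isPrimitive_not_isNondegenerate_of_model_annihilator_rat`, `exists_simple_degenerate_of_model_annihilator_rat` (the
  weight format with RATIONAL weights), **`exists_simple_degenerate_of_subgroup_annihilator`** (Galois dress, model-free).

## References

* [Shimura1998] G. Shimura, *Abelian Varieties with Complex Multiplication and Modular Functions*, §6.2 Thm. 3, §8.2 Prop. 26.
* [Gordon1999HodgeAVSurvey] B. B. Gordon, *A survey of the Hodge conjecture for abelian varieties*, Thm. 6.4, §9.3.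
* [Kubota1965] T. Kubota, *On the field extension by complex multiplication*, Trans. AMS 118 (1965), §2, §4 Lemma 2.
* [Dodson1984] B. Dodson, *The structure of Galois groups of CM-fields*, Trans. AMS 283 (1984), §3.1.1, §5.3.
-/

noncomputable section

open CategoryTheory CategoryTheory.Limits NumberField
open scoped BigOperators

namespace Summit.HodgeConjecture.CorCM.GaloisModels

open Literature.NumberTheory.ComplexMultiplication
open Literature.AlgebraicGeometry.Motives (AbelianVariety CMType)
open Literature.AlgebraicGeometry.HodgeTheory
open Literature.AlgebraicGeometry.ComplexMultiplication (IsCMTypeRealisation)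
open Literature.AlgebraicGeometry.Pohlmann1968
open Literature.Barriers.HodgeConjecture (divisorClassesSpan)
open Summit.HodgeConjecture.CorCM.GaloisRank
open Summit.HodgeConjecture.CorCM.AbelianSixteen (exists_simple_realisation_of_isPrimitive)

/-! ## §1 The abstract lift of a weight certificate -/

section Abstract

variable {G₀ H₀ : Type*} [Group G₀] [Group H₀]

/-- **Averaging over `N₁`.**  If `P` is invariant under right multiplication by the elements of a non-empty finite `N₁ ⊆ H₀` and
`b₁` has zero sums along every `x·N₁`, then `Σ_{x : P x} b₁(x) = 0`. [folklore] -/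
theorem sum_filter_eq_zero_of_coset_sums [Fintype H₀] [DecidableEq H₀] (N₁ : Finset H₀) (hne : N₁.Nonempty)
    (P : H₀ → Prop) [DecidablePred P] (hP : ∀ x, ∀ n ∈ N₁, P (x * n) ↔ P x) (b₁ : H₀ → ℚ)
    (hbal : ∀ x, ∑ n ∈ N₁, b₁ (x * n) = 0) : ∑ x ∈ Finset.univ.filter P, b₁ x = 0 := by
  have hshift : ∀ n ∈ N₁, ∑ x ∈ Finset.univ.filter P, b₁ x = ∑ x ∈ Finset.univ.filter P, b₁ (x * n) := by
    intro n hn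
    refine (Finset.sum_equiv (Equiv.mulRight n) (fun x => ?_) (fun x _ => rfl)).symm
    simp only [Finset.mem_filter, Finset.mem_univ, true_and, Equiv.coe_mulRight]
    exact (hP x n hn).symm
  have hsum : ∑ x ∈ Finset.univ.filter P, ∑ n ∈ N₁, b₁ (x * n) = (N₁.card : ℚ) * ∑ x ∈ Finset.univ.filter P, b₁ x := by
    rw [Finset.sum_comm, Finset.sum_congr rfl fun n hn => (hshift n hn).symm, Finset.sum_const, nsmul_eq_mul]
  simp only [hbal, Finset.sum_const_zero] at hsum
  rcases mul_eq_zero.mp hsum.symm with h | h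
  · exact absurd h (by exact_mod_cast hne.card_pos.ne')
  · exact h

/-- **LIFTING A WEIGHT CERTIFICATE FROM A SUBGROUP (abstract).**  `ι : H₀ ↪ G₀`, `c₁ ∈ H₀` with `c₁² = 1`; `N` a normal subgroup of
`G₀` inside `ι(H₀)` with `ι(c₁) ∉ N`, `N ≠ 1`, `N = ι(N₁)`.  A CM set `T₁ ⊆ H₀` for `c₁` with trivial left stabiliser and a non-zero
`c₁`-antisymmetric `b₁ : H₀ → ℚ` annihilated by all right translates of `T₁` and with zero sums along every `x·N₁` LIFT to a CM set
`T ⊆ G₀` for `ι(c₁)` with trivial left stabiliser and a non-zero `ι(c₁)`-antisymmetric `b : G₀ → ℚ` annihilated by all right translates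
of `T`: `T = ι(T₁) ∪ (S₀ ∖ ι(H₀))` for a right-`N`-invariant CM set `S₀`, `b = ι_* b₁`. [folklore] -/
theorem exists_weight_certificate_of_subgroup [Finite G₀] [DecidableEq G₀] [Fintype H₀] [DecidableEq H₀]
    (ι : H₀ →* G₀) (hι : Function.Injective ι) (c₁ : H₀) (hc2 : c₁ * c₁ = 1)
    (N : Subgroup G₀) [hN : N.Normal] (hNι : ∀ n ∈ N, n ∈ Set.range ι) (hcN : ι c₁ ∉ N) (hN1 : N ≠ ⊥)
    (N₁ : Finset H₀) (hN₁ : ∀ n₁, n₁ ∈ N₁ ↔ ι n₁ ∈ N)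
    (T₁ : Finset H₀) (hcm₁ : ∀ x, x ∈ T₁ ↔ c₁ * x ∉ T₁)
    (hprim₁ : ∀ v : H₀, v ≠ 1 → ∃ w, ¬ (w ∈ T₁ ↔ v * w ∈ T₁))
    (b₁ : H₀ → ℚ) (hanti₁ : ∀ y, b₁ (c₁ * y) = -b₁ y) (hann₁ : ∀ g : H₀, ∑ s ∈ T₁, b₁ (s * g) = 0)
    (hb₁ : ∃ y, b₁ y ≠ 0) (hbal₁ : ∀ x : H₀, ∑ n ∈ N₁, b₁ (x * n) = 0) :
    ∃ (T : Finset G₀) (b : G₀ → ℚ), (∀ x, x ∈ T ↔ ι c₁ * x ∉ T) ∧ (∀ v : G₀, v ≠ 1 → ∃ w, ¬ (w ∈ T ↔ v * w ∈ T)) ∧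
      (∀ y, b (ι c₁ * y) = -b y) ∧ (∀ g : G₀, ∑ s ∈ T, b (s * g) = 0) ∧ ∃ y, b y ≠ 0 := by
  classical
  haveI : Fintype G₀ := Fintype.ofFinite _
  obtain ⟨S₀, hS₀cm, hS₀N⟩ :=
    exists_cm_finset_mul_mem_iff N (ι c₁) (by rw [← map_mul, hc2, map_one]) hcN
  let emb : H₀ ↪ G₀ := ⟨ι, hι⟩
  let T : Finset G₀ := T₁.map emb ∪ S₀.filter fun y => y ∉ Set.range ι
  -- membership in `T` on and off the subgroup
  have hTι : ∀ h : H₀, ι h ∈ T ↔ h ∈ T₁ := fun h => by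
    constructor
    · intro hh
      rcases Finset.mem_union.mp hh with hh | hh
      · obtain ⟨h', hh', heq⟩ := Finset.mem_map.mp hh
        exact hι heq ▸ hh'
      · exact absurd (Set.mem_range_self h) (Finset.mem_filter.mp hh).2
    · intro hh
      exact Finset.mem_union.mpr (Or.inl (Finset.mem_map_of_mem emb hh))
  have hTout : ∀ y : G₀, y ∉ Set.range ι → (y ∈ T ↔ y ∈ S₀) := fun y hy => by
    constructor
    · intro hh
      rcases Finset.mem_union.mp hh with hh | hh
      · obtain ⟨h', -, heq⟩ := Finset.mem_map.mp hh
        exact absurd ⟨h', heq⟩ hy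
      · exact (Finset.mem_filter.mp hh).1
    · intro hh
      exact Finset.mem_union.mpr (Or.inr (Finset.mem_filter.mpr ⟨hh, hy⟩))
  -- products with an element off the subgroup stay off the subgroup
  have hout_left : ∀ v : G₀, v ∉ Set.range ι → ∀ z : H₀, v * ι z ∉ Set.range ι := fun v hv z ⟨y, hy⟩ =>
    hv ⟨y * z⁻¹, by rw [map_mul, hy, map_inv, mul_inv_cancel_right]⟩
  have hout_right : ∀ g : G₀, g ∉ Set.range ι → ∀ z : H₀, ι z * g ∉ Set.range ι := fun g hg z ⟨y, hy⟩ =>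
    hg ⟨z⁻¹ * y, by rw [map_mul, hy, map_inv, inv_mul_cancel_left]⟩
  -- the lifted weight `b = ι_* b₁`
  let b : G₀ → ℚ := fun y => if h : ∃ x, ι x = y then b₁ h.choose else 0
  have hbι : ∀ x, b (ι x) = b₁ x := fun x => by
    have h : ∃ x', ι x' = ι x := ⟨x, rfl⟩
    simp only [b, dif_pos h]
    rw [hι h.choose_spec]
  have hbout : ∀ y, y ∉ Set.range ι → b y = 0 := fun y hy => by
    have h : ¬ ∃ x, ι x = y := fun ⟨x, hx⟩ => hy ⟨x, hx⟩
    simp only [b, dif_neg h]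
  refine ⟨T, b, ?_, ?_, ?_, ?_, ?_⟩
  · -- `T` is a CM set for `ι c₁`
    intro y
    by_cases hy : y ∈ Set.range ι
    · obtain ⟨h, rfl⟩ := hy
      rw [← map_mul, hTι, hTι]
      exact hcm₁ h
    · have hcy : ι c₁ * y ∉ Set.range ι := fun ⟨h, hh⟩ =>
        hy ⟨c₁⁻¹ * h, by rw [map_mul, hh, map_inv, inv_mul_cancel_left]⟩
      rw [hTout y hy, hTout _ hcy]
      exact hS₀cm y
  · -- trivial left stabiliser
    intro v hv
    by_cases hvr : v ∈ Set.range ι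
    · obtain ⟨v₁, rfl⟩ := hvr
      have hv₁ : v₁ ≠ 1 := by
        rintro rfl
        exact hv (map_one ι)
      obtain ⟨w₁, hw₁⟩ := hprim₁ v₁ hv₁
      exact ⟨ι w₁, by rwa [← map_mul, hTι, hTι]⟩
    · by_contra hall
      push Not at hall
      obtain ⟨n, hnN, hn1⟩ : ∃ n ∈ N, n ≠ 1 := by
        by_contra h
        push Not at h
        exact hN1 ((Subgroup.eq_bot_iff_forall N).mpr h)
      obtain ⟨n₁, rfl⟩ := hNι n hnN
      have hn₁ : n₁ ≠ 1 := by
        rintro rfl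
        exact hn1 (map_one ι)
      obtain ⟨w₁, hw₁⟩ := hprim₁ n₁ hn₁
      apply hw₁
      -- `T₁` is invariant under right multiplication by `ι⁻¹(N)`
      have key : ∀ h m : H₀, ι m ∈ N → (h * m ∈ T₁ ↔ h ∈ T₁) := fun h m hm => by
        have h1 := hall (ι h)
        have h2 := hall (ι (h * m))
        rw [hTι] at h1 h2
        rw [h1, h2, hTout _ (hout_left v hvr _), hTout _ (hout_left v hvr _), map_mul, ← mul_assoc]
        exact hS₀N _ _ hm
      have hconj : ι (w₁⁻¹ * n₁ * w₁) ∈ N := by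
        rw [map_mul, map_mul, map_inv]
        have := hN.conj_mem _ hnN (ι w₁)⁻¹
        rwa [inv_inv] at this
      rw [show n₁ * w₁ = w₁ * (w₁⁻¹ * n₁ * w₁) by group]
      exact (key w₁ _ hconj).symm
  · -- antisymmetric
    intro y
    by_cases hy : y ∈ Set.range ι
    · obtain ⟨x, rfl⟩ := hy
      rw [← map_mul, hbι, hbι]
      exact hanti₁ x
    · have hcy : ι c₁ * y ∉ Set.range ι := fun ⟨h, hh⟩ =>
        hy ⟨c₁⁻¹ * h, by rw [map_mul, hh, map_inv, inv_mul_cancel_left]⟩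
      rw [hbout y hy, hbout _ hcy, neg_zero]
  · -- annihilated
    intro g
    have hsplit : ∑ s ∈ T, b (s * g) =
        ∑ s ∈ T₁.map emb, b (s * g) + ∑ s ∈ S₀.filter (fun y => y ∉ Set.range ι), b (s * g) := by
      apply Finset.sum_union
      rw [Finset.disjoint_left]
      intro s hs hs'
      obtain ⟨h', -, heq⟩ := Finset.mem_map.mp hs
      exact (Finset.mem_filter.mp hs').2 ⟨h', heq⟩
    rw [hsplit, Finset.sum_map]
    by_cases hg : g ∈ Set.range ι
    · obtain ⟨g₁, rfl⟩ := hg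
      have h1 : ∑ x ∈ T₁, b (emb x * ι g₁) = ∑ x ∈ T₁, b₁ (x * g₁) :=
        Finset.sum_congr rfl fun x _ => by
          change b (ι x * ι g₁) = _
          rw [← map_mul, hbι]
      have h2 : ∑ s ∈ S₀.filter (fun y => y ∉ Set.range ι), b (s * ι g₁) = 0 :=
        Finset.sum_eq_zero fun s hs => hbout _ (hout_left s (Finset.mem_filter.mp hs).2 g₁)
      rw [h1, h2, hann₁ g₁, add_zero]
    · have h1 : ∑ x ∈ T₁, b (emb x * g) = 0 :=
        Finset.sum_eq_zero fun x _ => hbout _ (hout_right g hg x)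
      rw [h1, zero_add]
      -- reindex `s ↦ s g` and drop the terms with `s g ∉ ι(H₀)`
      have h2 : ∑ s ∈ S₀.filter (fun y => y ∉ Set.range ι), b (s * g) =
          ∑ x ∈ Finset.univ.filter (fun x : H₀ => ι x * g⁻¹ ∈ S₀), b₁ x := by
        rw [← Finset.sum_filter_add_sum_filter_not (S₀.filter fun y => y ∉ Set.range ι) (fun s => s * g ∈ Set.range ι)
          (fun s => b (s * g))]
        have hz : ∑ s ∈ (S₀.filter fun y => y ∉ Set.range ι).filter (fun s => ¬ s * g ∈ Set.range ι), b (s * g) = 0 :=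
          Finset.sum_eq_zero fun s hs => hbout _ (Finset.mem_filter.mp hs).2
        rw [hz, add_zero]
        symm
        refine Finset.sum_bij (fun x _ => ι x * g⁻¹) (fun x hx => ?_) (fun x _ y _ hxy => ?_) (fun s hs => ?_)
          (fun x _ => ?_)
        · simp only [Finset.mem_filter, Finset.mem_univ, true_and] at hx
          refine Finset.mem_filter.mpr ⟨Finset.mem_filter.mpr ⟨hx, ?_⟩, ⟨x, (inv_mul_cancel_right (ι x) g).symm⟩⟩
          rintro ⟨y, hy⟩
          exact hg ⟨y⁻¹ * x, by rw [map_mul, map_inv, hy, mul_inv_rev, inv_inv, mul_assoc, inv_mul_cancel, mul_one]⟩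
        · exact hι (mul_right_cancel hxy)
        · simp only [Finset.mem_filter] at hs
          obtain ⟨⟨hsS, -⟩, ⟨x, hx⟩⟩ := hs
          refine ⟨x, ?_, ?_⟩
          · simp only [Finset.mem_filter, Finset.mem_univ, true_and]
            rwa [hx, mul_inv_cancel_right]
          · rw [hx, mul_inv_cancel_right]
        · rw [inv_mul_cancel_right, hbι]
      rw [h2]
      -- the index set is a union of right `ι⁻¹(N)`-cosets: average over `N₁`
      have hne : N₁.Nonempty := ⟨1, (hN₁ 1).mpr (by rw [map_one]; exact N.one_mem)⟩
      refine sum_filter_eq_zero_of_coset_sums N₁ hne _ (fun x n hn => ?_) b₁ hbal₁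
      have hnN : ι n ∈ N := (hN₁ n).mp hn
      have hn' : g * ι n * g⁻¹ ∈ N := hN.conj_mem _ hnN g
      have heq : ι (x * n) * g⁻¹ = ι x * g⁻¹ * (g * ι n * g⁻¹) := by
        rw [map_mul]
        group
      rw [heq]
      exact hS₀N _ _ hn'
  · -- non-zero
    obtain ⟨y₁, hy₁⟩ := hb₁
    exact ⟨ι y₁, by rwa [hbι]⟩

end Abstract

/-! ## §2 Rational weights; Galois dress (model-free) -/

variable {K : Type} [Field K] [NumberField K] [IsCMField K]

/-- **Model certificate with a RATIONAL weight ⟹ primitive degenerate CM type.**  As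
`exists_isPrimitive_not_isNondegenerate_of_model_annihilator` with `b : G₀ → ℚ`. [cite: Kubota1965, §2]
[cite: Gordon1999HodgeAVSurvey, §9.3] [cite: Shimura1998, §8.2 Prop. 26] -/
theorem exists_isPrimitive_not_isNondegenerate_of_model_annihilator_rat [IsGalois ℚ K] {G₀ : Type*} [Group G₀]
    [Fintype G₀] [DecidableEq G₀] (e : (K ≃ₐ[ℚ] K) ≃* G₀) (c₀ : G₀)
    (hc : e ((IsCMField.complexConj K).restrictScalars ℚ) = c₀) (T₀ : Finset G₀)
    (hcm : ∀ x : G₀, x ∈ T₀ ↔ c₀ * x ∉ T₀) (hprim : ∀ v : G₀, v ≠ 1 → ∃ w : G₀, ¬ (w ∈ T₀ ↔ v * w ∈ T₀))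
    (b : G₀ → ℚ) (hanti : ∀ y, b (c₀ * y) = -b y) (hann : ∀ g : G₀, ∑ s ∈ T₀, b (s * g) = 0) (hb : ∃ y, b y ≠ 0)
    (φ₀ : K →+* ℂ) : ∃ Φ : CMType K, IsPrimitive (ℂ ≃+* ℂ) Φ.1 φ₀ ∧ ¬ IsNondegenerate Φ := by
  classical
  obtain ⟨Φ, hprimΦ, hread⟩ := GaloisTable.exists_isPrimitive_of_tableModel (K := K) (X := G₀)
    (fun y z => y * z) e.toEquiv (fun _ _ => map_mul e _ _) c₀ hc 1 (map_one e) T₀ hcm hprim φ₀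
  refine ⟨Φ, hprimΦ, fun hnd => ?_⟩
  obtain ⟨y₀, hy₀⟩ := hb
  have hS : ∀ y : G₀, y ∈ T₀ ↔ embOf φ₀ (e.symm y) ∈ Φ.1 := fun y => hread y
  have hzero := (isNondegenerate_iff_forall_annihilator e hc Φ φ₀ T₀ hS).1 hnd b hanti hann
  exact hy₀ (congrFun hzero y₀)

/-- **… realised: a SIMPLE DEGENERATE CM abelian variety of dimension `|G₀|/2`** with an exceptional Hodge class on some power
(rational-weight form of `exists_simple_degenerate_of_model_annihilator`). [cite: Shimura1998, §6.2 Thm. 3 and §8.2 Prop. 26]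
[cite: Gordon1999HodgeAVSurvey, Thm. 6.4] -/
theorem exists_simple_degenerate_of_model_annihilator_rat [IsGalois ℚ K] {G₀ : Type*} [Group G₀] [Fintype G₀]
    [DecidableEq G₀] (e : (K ≃ₐ[ℚ] K) ≃* G₀) (c₀ : G₀) (hc : e ((IsCMField.complexConj K).restrictScalars ℚ) = c₀)
    (T₀ : Finset G₀) (hcm : ∀ x : G₀, x ∈ T₀ ↔ c₀ * x ∉ T₀)
    (hprim : ∀ v : G₀, v ≠ 1 → ∃ w : G₀, ¬ (w ∈ T₀ ↔ v * w ∈ T₀)) (b : G₀ → ℚ)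
    (hanti : ∀ y, b (c₀ * y) = -b y) (hann : ∀ g : G₀, ∑ s ∈ T₀, b (s * g) = 0) (hb : ∃ y, b y ≠ 0) :
    ∃ (Φ : CMType K) (φ₀ : K →+* ℂ) (A : AbelianVariety ℂ) (ι : 𝓞 K →+* End A)
      (θ : K →+* Module.End ℂ (complexBetti A.X 1)),
      IsPrimitive (ℂ ≃+* ℂ) Φ.1 φ₀ ∧ ¬ IsNondegenerate Φ ∧ IsCMTypeRealisation Φ A ι θ ∧ A.IsSimple ∧
      A.dim = Fintype.card G₀ / 2 ∧
      ∃ n p : ℕ, ∃ x : complexBetti (⨁ fun _ : Fin n => A).X (2 * p), IsRationalClass x ∧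
        IsOfHodgeType (⨁ fun _ : Fin n => A).dim (⨁ fun _ : Fin n => A).X (2 * p) p p x ∧
        x ∉ divisorClassesSpan (⨁ fun _ : Fin n => A).X (⨁ fun _ : Fin n => A).dim p := by
  obtain ⟨φ₀⟩ := (inferInstance : Nonempty (K →+* ℂ))
  obtain ⟨Φ, hprimΦ, hdeg⟩ :=
    exists_isPrimitive_not_isNondegenerate_of_model_annihilator_rat e c₀ hc T₀ hcm hprim b hanti hann hb φ₀
  obtain ⟨A, ι, θ, hA, hs, hdim⟩ := exists_simple_realisation_of_isPrimitive Φ φ₀ hprimΦ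
  refine ⟨Φ, φ₀, A, ι, θ, hprimΦ, hdeg, hA, hs, ?_, exists_exceptional_pow_of_not_isNondegenerate φ₀ hprimΦ hdeg hA⟩
  rw [hdim, card_model_eq_finrank e]

/-- **A WEIGHT CERTIFICATE ON A SUBGROUP OF `Gal(K/ℚ)`, BALANCED OVER A NORMAL SUBGROUP `N`, MAKES `K` BAD.**
`ι : H₀ ↪ Gal(K/ℚ)` with `ι(c₁) =` complex conjugation; `N ◁ Gal(K/ℚ)`, `1 ≠ N ⊆ ι(H₀)`, `c ∉ N`, `N₁ = ι⁻¹(N)` as a finset; a CM set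
`T₁ ⊆ H₀` for `c₁` with trivial left stabiliser and a non-zero `c₁`-antisymmetric `b₁ : H₀ → ℚ` annihilated by all right translates of
`T₁` and with zero sums along every `x·N₁`.  Then `K` carries a PRIMITIVE DEGENERATE CM type, realised by a SIMPLE abelian variety of
dimension `[K:ℚ]/2` with a rational `(p,p)` class outside the divisor ring on some power. [cite: Shimura1998, §6.2 Thm. 3 and §8.2 Prop. 26]
[cite: Gordon1999HodgeAVSurvey, Thm. 6.4 and §9.3] -/
theorem exists_simple_degenerate_of_subgroup_annihilator [IsGalois ℚ K] {H₀ : Type*} [Group H₀] [Fintype H₀]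
    [DecidableEq H₀] (ι : H₀ →* (K ≃ₐ[ℚ] K)) (hι : Function.Injective ι) (c₁ : H₀)
    (hc : ι c₁ = (IsCMField.complexConj K).restrictScalars ℚ)
    (N : Subgroup (K ≃ₐ[ℚ] K)) [N.Normal] (hNι : ∀ n ∈ N, n ∈ Set.range ι)
    (hcN : (IsCMField.complexConj K).restrictScalars ℚ ∉ N) (hN1 : N ≠ ⊥)
    (N₁ : Finset H₀) (hN₁ : ∀ n₁, n₁ ∈ N₁ ↔ ι n₁ ∈ N)
    (T₁ : Finset H₀) (hcm₁ : ∀ x, x ∈ T₁ ↔ c₁ * x ∉ T₁)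
    (hprim₁ : ∀ v : H₀, v ≠ 1 → ∃ w, ¬ (w ∈ T₁ ↔ v * w ∈ T₁))
    (b₁ : H₀ → ℚ) (hanti₁ : ∀ y, b₁ (c₁ * y) = -b₁ y) (hann₁ : ∀ g : H₀, ∑ s ∈ T₁, b₁ (s * g) = 0)
    (hb₁ : ∃ y, b₁ y ≠ 0) (hbal₁ : ∀ x : H₀, ∑ n ∈ N₁, b₁ (x * n) = 0) :
    ∃ (Φ : CMType K) (φ₀ : K →+* ℂ) (A : AbelianVariety ℂ) (ι' : 𝓞 K →+* End A)
      (θ : K →+* Module.End ℂ (complexBetti A.X 1)),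
      IsPrimitive (ℂ ≃+* ℂ) Φ.1 φ₀ ∧ ¬ IsNondegenerate Φ ∧ IsCMTypeRealisation Φ A ι' θ ∧ A.IsSimple ∧
      A.dim = Module.finrank ℚ K / 2 ∧
      ∃ n p : ℕ, ∃ x : complexBetti (⨁ fun _ : Fin n => A).X (2 * p), IsRationalClass x ∧
        IsOfHodgeType (⨁ fun _ : Fin n => A).dim (⨁ fun _ : Fin n => A).X (2 * p) p p x ∧
        x ∉ divisorClassesSpan (⨁ fun _ : Fin n => A).X (⨁ fun _ : Fin n => A).dim p := by
  classical
  haveI : Fintype (K ≃ₐ[ℚ] K) := Fintype.ofFinite _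
  have hc2 : c₁ * c₁ = 1 := hι (by rw [map_mul, hc, GaloisOctic.complexConj_mul_self, map_one])
  obtain ⟨T, b, hcm, hprim, hanti, hann, hb⟩ := exists_weight_certificate_of_subgroup ι hι c₁ hc2 N hNι
    (by rw [hc]; exact hcN) hN1 N₁ hN₁ T₁ hcm₁ hprim₁ b₁ hanti₁ hann₁ hb₁ hbal₁
  rw [hc] at hcm hanti
  have h := exists_simple_degenerate_of_model_annihilator_rat (MulEquiv.refl (K ≃ₐ[ℚ] K)) _ rfl T hcm hprim b hanti hann hb
  rwa [card_model_eq_finrank (MulEquiv.refl (K ≃ₐ[ℚ] K))] at h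

end Summit.HodgeConjecture.CorCM.GaloisModels

end
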